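import Summits.HodgeConjecture.HodgeConjecture.Theorems.F0P3HJ3aAssembly
import Summits.HodgeConjecture.HodgeConjecture.Theorems.F0P3StubS4Fold
import Summits.HodgeConjecture.HodgeConjecture.Theorems.F0P3StubS5Holds
import Summits.HodgeConjecture.HodgeConjecture.Theorems.HCCMUnconditionalH413OfFacts
import HarnessLib

/-!
# Crux `H413` — `hJ3a` (row III-J3a, multiplicity `≤ 1` at the pin) and `H413` itself FROM THE EIGHT PRINTED-CITATION LETTERS BY NAME

Floor-0 programme P3 «U3-mult», seat F0P3-p02 (g0); crux item stmt-HodgeConjecture-24833 (`HCCMUnconditional.H413`); line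
`Cruxes/H413/Lines/F0_U3CohMultOne.lean` (v1.3 bff04c9c); lead's order F0/P3 bus 2026-08-30T22:44:08Z.
HC_CM is proved only modulo the printed citations until rung 0 closes.

THE ASSEMBLY LEG, Theorems-side (importable by a floor file; no `Cruxes/…/Lines` workfile is imported):
* `hJ3a_of_letters` — the floor binder `hJ3a` of ★ `hc_cm_of_generic_floor_v7` (ll. 76–80; = the type `HJ3aType` of the line, = the registered
  stub `stub_multiplicity_le_one_printed` of `Cruxes/H413/Lines/a3_liu413.lean` v10.2) from the EIGHT letters, all ★ named facts cited BY NAME: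
  E1 `Rogawski1990.innerFormMultiplicityLeOne`, E1′ `cohFinComponentUnique_hol` / `_antihol`, E2′ `hodgeTypeRigid`
  (`Literature/NumberTheory/Rogawski1990/CohomologicalSpectrumInnerForm.lean`), (D) `CotangentForms.holCotFormSpectralProjection` / `antihol…`, (E)
  `CotangentForms.cohIsotypicLine_hol` / `_antihol` (`Literature/NumberTheory/Automorphic/UnitaryGroupCotangentSpectralProjection.lean`).  Proof = F0P3-p01's
  ★ `F0P3HJ3aAssembly.hJ3a_of_S345` (the line's kernel composition `rank_intertwiningMap_le_one_of_split` with S1 := ★ `F0P3StubS1Dec.stubS1_holds`,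
  S2 := ★ `F0P3StubS2HodgeTypes.stubS2_holds`) applied to S3 := ★ `F0P3StubS3S4Holds.stubS3_holds hE1 hE1'h hDh hEh`, S4 := ★
  `F0P3StubS3S4Holds.stubS4_holds hE1 hE1'a hDa hEa` (F0P3-p03, `Theorems/F0P3StubS3Fold.lean`, `F0P3StubS4Fold.lean`) and S5 := ★ `F0P3StubS5Fold.stubS5_holds hE2' hDh hDa` (F0P3-p02).
* `H413_of_letters` — the crux decl `HCCMUnconditional.H413` BY NAME from the eight letters and the two OTHER floor rows as hypotheses (their binder
  types `hdictE` ll. 70–75 and `hocc` ll. 81–86 VERBATIM; programmes P2 / P4), via ★ `Hyp413Closing.H413_of_three_facts_flat`.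
Every hypothesis left is a PRINTED-CITATION LETTER (`def … : Prop`, D-0014) or another floor row: this is the honest label made formal.

References: [Liu2021] arXiv:2102.11518, Prop. 4.13 and proof l. 2121–2146, Rem. 4.14; [Rogawski1990] Thm. 13.3.5, 13.3.6 (c), §14.6 (Prop. 14.6.2,
Thm. 14.6.4, 14.6.5), §15.3 ¶1, §12.3, Prop. 15.2.1 (b); [BorelJacquet1979] §4.6; [Borel1997] Thm. 2.13, §8.4; [BorelWallach2000] VI 4.11, VII 3.2/3.6;
[Flath1979] §2; [GelbartRogawski1991] Thm. 5.1.1; [Li1992] Thm. 2.1.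
-/

-- the mandated namespace repeats `HodgeConjecture.HodgeConjecture`, as in every `Theorems/*.lean` of this sub-problem
set_option linter.dupNamespace false

noncomputable section

namespace Summit.HodgeConjecture.HodgeConjecture.Cruxes.H413.HJ3aOfLetters

open scoped TensorProduct Matrix
open NumberField NumberField.InfinitePlace IsDedekindDomain
open HodgeCM.Model HodgeCM.Model.LiuIndex HodgeCM.Model.TowerCarrier
open Summit.HodgeConjecture.CorCM.Model
open Literature.AlgebraicGeometry.Motives (CMType AbelianVariety)
open Literature.AlgebraicGeometry.HodgeTheory Literature.NumberTheory.Automorphic.PicardCM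
open Literature.AlgebraicGeometry.ShimuraVarieties Literature.AlgebraicGeometry.ShimuraVarieties.UnitaryCanonicalModel
open Literature.NumberTheory.ComplexMultiplication
open Literature.NumberTheory.Automorphic
open Literature.NumberTheory.Automorphic.Liu2021 Literature.NumberTheory.Automorphic.Liu2021.AppendixC
open Literature.NumberTheory.Automorphic.Liu2021.Def411WeilCarriers (lineOf locF Rep)
open Summit.HodgeConjecture.CorCM.Transposition.OmegaTransport (realUnit)
open HodgeCM.Model.ArchSideTerm (e₁)
open Literature.NumberTheory.GelbartRogawski1991 Literature.NumberTheory.GelbartRogawski1991.UnitaryDualPair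
open Literature.RepresentationTheory Literature.RepresentationTheory.Liu2021
open Summit.HodgeConjecture.CorCM
open Summit.HodgeConjecture.CorCM.Transposition
open Literature.NumberTheory.GelbartRogawski1991.OscillatorTripleDictionary (OccursInH1 IsIsoToOmega)
open Summit.HodgeConjecture.CorCM.Lines.A3Liu418 (Thm415AtFace EpsRigidAtFace)
open Summit.HodgeConjecture.HodgeConjecture.Theses (HCCMUnconditional.HDel)
open MulAction
open Literature.Geometry.ComplexHyperbolic.BallModel (U21 x₀)
open Literature.NumberTheory.GelbartRogawski1991.OscillatorTripleDictionary (rhoTriple)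
open Summit.HodgeConjecture.CorCM.Lines.A3Liu413 (datum413)
open Summit.HodgeConjecture.HodgeConjecture.Cruxes.H413.CohFormsCarriers
open Summit.HodgeConjecture.HodgeConjecture.Cruxes.H413.F0P3HJ3aAssembly (hJ3a_of_S345)
open Summit.HodgeConjecture.HodgeConjecture.Cruxes.H413.F0P3StubS3S4Holds (stubS3_holds stubS4_holds)
open Summit.HodgeConjecture.HodgeConjecture.Cruxes.H413.F0P3StubS5Fold (stubS5_holds)

set_option synthInstance.maxHeartbeats 400000 in
set_option maxHeartbeats 8000000 in
/-- **`hJ3a` FROM THE EIGHT LETTERS** (row III-J3a of the floor: `rank_ℂ Hom_{U(V)(𝔸_{F⁺,f})}(ω_V(t), H¹_{B,τ'}) ≤ 1` for every face, `3 ≤ n`, `τ'`, `t`); conclusion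
= the body of `HJ3aType` = floor V7 ll. 76–80 VERBATIM.  All eight hypotheses are ★ NAMED FACTS (printed citations): E1, E1′hol, E1′antihol, E2′, (D)hol,
(D)antihol, (E)hol, (E)antihol. HC_CM is proved only modulo the printed citations until rung 0 closes. [cite: Liu2021, proof of Prop. 4.13, l. 2121–2146; Rem. 4.14]
[cite: Rogawski1990, Thm. 14.6.4; Thm. 13.3.6 (c); §15.3 ¶1; §12.3 p. 174; Thm. 13.3.5] [cite: BorelJacquet1979, §4.6] [cite: BorelWallach2000, VII 3.2 and 3.6] -/
theorem hJ3a_of_letters (hE1 : Literature.NumberTheory.Rogawski1990.innerFormMultiplicityLeOne)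
    (hE1'h : Literature.NumberTheory.Rogawski1990.cohFinComponentUnique_hol)
    (hE1'a : Literature.NumberTheory.Rogawski1990.cohFinComponentUnique_antihol)
    (hE2' : Literature.NumberTheory.Rogawski1990.hodgeTypeRigid)
    (hDh : Literature.NumberTheory.Automorphic.UnitaryGroup.CotangentForms.holCotFormSpectralProjection)
    (hDa : Literature.NumberTheory.Automorphic.UnitaryGroup.CotangentForms.antiholCotFormSpectralProjection)
    (hEh : Literature.NumberTheory.Automorphic.UnitaryGroup.CotangentForms.cohIsotypicLine_hol)
    (hEa : Literature.NumberTheory.Automorphic.UnitaryGroup.CotangentForms.cohIsotypicLine_antihol) :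
    ∀ (hDel : Literature.AlgebraicGeometry.ShimuraVarieties.UnitaryCanonicalModel.canonicalModel_exists_printed)
    (F : HodgeCM.CMField) [IsGalois ℚ F] (h6 : 6 ≤ Module.finrank ℚ F) {ι₁ : F →+* ℂ} (V : HodgeCM.HermSpace3 F ι₁) (a₀ : RealScalar F)
    (Φ : CMType F) (hΦ : ι₁ ∈ Φ.1) (i : (I V (repAt a₀) (muLiu ι₁ GramClass.rep))),
    (((uniformOmegaRep (Summit.HodgeConjecture.CorCM.DelRec.exists_recordSystem_of_printed hDel) ⟨HodgeCM.CMField.K F⟩ ι₁ ⟨HodgeCM.HermSpace3.Hm V, HodgeCM.HermSpace3.isHermitian V, HodgeCM.HermSpace3.signature_ι₁ V, HodgeCM.HermSpace3.posDef_of_ne V⟩ Φ e₁ (frameD V) (frameD_real V) (frameD_ne V) (ιVE V) (2 * imagUnit (HodgeCM.CMField.K F))⁻¹ (fun _ _ => (Rep.update ↥(maximalRealSubfield (HodgeCM.CMField.K F)) (imagUnitSq (HodgeCM.CMField.K F)) (Rep.ofLineOf ↥(maximalRealSubfield (HodgeCM.CMField.K F)) (imagUnitSq (HodgeCM.CMField.K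 F))) (locF ↥(maximalRealSubfield (HodgeCM.CMField.K F)) (imagUnitSq (HodgeCM.CMField.K F)) (realUnit ⟨HodgeCM.CMField.K F⟩ (repAt a₀ (Sigma.fst i)).1 (repAt a₀ (Sigma.fst i)).2.1 (repAt a₀ (Sigma.fst i)).2.2)) (realUnit ⟨HodgeCM.CMField.K F⟩ (repAt a₀ (Sigma.fst i)).1 (repAt a₀ (Sigma.fst i)).2.1 (repAt a₀ (Sigma.fst i)).2.2) rfl)))).prop413Data ((liuDictionaryPin exists_isReal_hodgeModel_holds hodgePQ_independent_of_hodgeModel_holds BallQuotient.ballQuotientUniformised_holds (cmAbelianVarietyRealised_of_eigenbasis exists_isReal_hodgeModel_holds hodgePQ_independent_of_hodgeModel_holds cmAbelianVarietyEigenbasisRealised_holds) Literature.NumberTheory.Transcendental.arapura2012_cor_15_4_6_holds V (I V (repAt a₀) (muLiu ι₁ GramClass.rep)) (line V (repAt a₀) (muLiu ι₁ GramClass.rep)))).H).multiplicity_le_one_printed :=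
  hJ3a_of_S345 (stubS3_holds hE1 hE1'h hDh hEh) (stubS4_holds hE1 hE1'a hDa hEa) (stubS5_holds hE2' hDh hDa)

set_option synthInstance.maxHeartbeats 400000 in
set_option maxHeartbeats 8000000 in
/-- **THE CRUX `HCCMUnconditional.H413` BY NAME FROM THE EIGHT LETTERS AND THE TWO OTHER FLOOR ROWS** (`hdictE` = row III-2 (a)′, programme P2's target, ll. 70–75
verbatim; `hocc` = row III-2 (c)′, programme P4's target, ll. 81–86 verbatim), via ★ `Hyp413Closing.H413_of_three_facts_flat hdictE hJ3a hocc`.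
HC_CM is proved only modulo the printed citations until rung 0 closes. [cite: Liu2021, Prop. 4.13; Rem. 4.14] [cite: Rogawski1990, Thm. 14.6.4; §15.3]
[cite: GelbartRogawski1991, Thm 5.1.1 p. 465] [cite: Li1992, Thm. 2.1] -/
theorem H413_of_letters (hE1 : Literature.NumberTheory.Rogawski1990.innerFormMultiplicityLeOne)
    (hE1'h : Literature.NumberTheory.Rogawski1990.cohFinComponentUnique_hol)
    (hE1'a : Literature.NumberTheory.Rogawski1990.cohFinComponentUnique_antihol)
    (hE2' : Literature.NumberTheory.Rogawski1990.hodgeTypeRigid)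
    (hDh : Literature.NumberTheory.Automorphic.UnitaryGroup.CotangentForms.holCotFormSpectralProjection)
    (hDa : Literature.NumberTheory.Automorphic.UnitaryGroup.CotangentForms.antiholCotFormSpectralProjection)
    (hEh : Literature.NumberTheory.Automorphic.UnitaryGroup.CotangentForms.cohIsotypicLine_hol)
    (hEa : Literature.NumberTheory.Automorphic.UnitaryGroup.CotangentForms.cohIsotypicLine_antihol)
    (hdictE :
      ∀ (hDel : Literature.AlgebraicGeometry.ShimuraVarieties.UnitaryCanonicalModel.canonicalModel_exists_printed)
      (F : HodgeCM.CMField) [IsGalois ℚ F] (h6 : 6 ≤ Module.finrank ℚ F) {ι₁ : F →+* ℂ} (V : HodgeCM.HermSpace3 F ι₁) (a₀ : RealScalar F)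
      (Φ : CMType F) (hΦ : ι₁ ∈ Φ.1) (i : (I V (repAt a₀) (muLiu ι₁ GramClass.rep))),
      oscillatorTriple_dictionaryExistence (((uniformOmegaRep (Summit.HodgeConjecture.CorCM.DelRec.exists_recordSystem_of_printed hDel) ⟨HodgeCM.CMField.K F⟩ ι₁ ⟨HodgeCM.HermSpace3.Hm V, HodgeCM.HermSpace3.isHermitian V, HodgeCM.HermSpace3.signature_ι₁ V, HodgeCM.HermSpace3.posDef_of_ne V⟩ Φ e₁ (frameD V) (frameD_real V) (frameD_ne V) (ιVE V) (2 * imagUnit (HodgeCM.CMField.K F))⁻¹ (fun _ _ => (Rep.update ↥(maximalRealSubfield (HodgeCM.CMField.K F)) (imagUnitSq (HodgeCM.CMField.K F)) (Rep.ofLineOf ↥(maximalRealSubfield (HodgeCM.CMField.K F)) (imagUnitSq (HodgeCM.CMField.K F))) (locF ↥(maximalRealSubfield (HodgeCM.CMField.K F)) (imagUnitSq (HodgeCM.CMField.K F)) (realUnit ⟨HodgeCM.CMField.K F⟩ (repAt a₀ (Sigma.fst i)).1 (repAt a₀ (Sigma.fst i)).2.1 (repAt a₀ (Sigma.fst i)).2.2))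 (realUnit ⟨HodgeCM.CMField.K F⟩ (repAt a₀ (Sigma.fst i)).1 (repAt a₀ (Sigma.fst i)).2.1 (repAt a₀ (Sigma.fst i)).2.2) rfl)))).prop413Data ((liuDictionaryPin exists_isReal_hodgeModel_holds hodgePQ_independent_of_hodgeModel_holds BallQuotient.ballQuotientUniformised_holds (cmAbelianVarietyRealised_of_eigenbasis exists_isReal_hodgeModel_holds hodgePQ_independent_of_hodgeModel_holds cmAbelianVarietyEigenbasisRealised_holds) Literature.NumberTheory.Transcendental.arapura2012_cor_15_4_6_holds V (I V (repAt a₀) (muLiu ι₁ GramClass.rep)) (line V (repAt a₀) (muLiu ι₁ GramClass.rep)))).H))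
    (hocc :
      ∀ (hDel : Literature.AlgebraicGeometry.ShimuraVarieties.UnitaryCanonicalModel.canonicalModel_exists_printed)
      (F : HodgeCM.CMField) [IsGalois ℚ F] (h6 : 6 ≤ Module.finrank ℚ F) {ι₁ : F →+* ℂ} (V : HodgeCM.HermSpace3 F ι₁) (a₀ : RealScalar F)
      (Φ : CMType F) (hΦ : ι₁ ∈ Φ.1) (i : (I V (repAt a₀) (muLiu ι₁ GramClass.rep))),
      admissible_occursInH1 (((uniformOmegaRep (Summit.HodgeConjecture.CorCM.DelRec.exists_recordSystem_of_printed hDel) ⟨HodgeCM.CMField.K F⟩ ι₁ ⟨HodgeCM.HermSpace3.Hm V, HodgeCM.HermSpace3.isHermitian V, HodgeCM.HermSpace3.signature_ι₁ V, HodgeCM.HermSpace3.posDef_of_ne V⟩ Φ e₁ (frameD V) (frameD_real V) (frameD_ne V) (ιVE V) (2 * imagUnit (HodgeCM.CMField.K F))⁻¹ (fun _ _ => (Rep.update ↥(maximalRealSubfield (HodgeCM.CMField.K F)) (imagUnitSq (HodgeCM.CMField.K F)) (Rep.ofLineOf ↥(maximalRealSubfield (HodgeCM.CMField.K F)) (imagUnitSq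 (HodgeCM.CMField.K F))) (locF ↥(maximalRealSubfield (HodgeCM.CMField.K F)) (imagUnitSq (HodgeCM.CMField.K F)) (realUnit ⟨HodgeCM.CMField.K F⟩ (repAt a₀ (Sigma.fst i)).1 (repAt a₀ (Sigma.fst i)).2.1 (repAt a₀ (Sigma.fst i)).2.2)) (realUnit ⟨HodgeCM.CMField.K F⟩ (repAt a₀ (Sigma.fst i)).1 (repAt a₀ (Sigma.fst i)).2.1 (repAt a₀ (Sigma.fst i)).2.2) rfl)))).prop413Data ((liuDictionaryPin exists_isReal_hodgeModel_holds hodgePQ_independent_of_hodgeModel_holds BallQuotient.ballQuotientUniformised_holds (cmAbelianVarietyRealised_of_eigenbasis exists_isReal_hodgeModel_holds hodgePQ_independent_of_hodgeModel_holds cmAbelianVarietyEigenbasisRealised_holds) Literature.NumberTheory.Transcendental.arapura2012_cor_15_4_6_holds V (I V (repAt a₀) (muLiu ι₁ GramClass.rep)) (line V (repAt a₀) (muLiu ι₁ GramClass.rep)))).H)) :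
    Summit.HodgeConjecture.HodgeConjecture.Theses.HCCMUnconditional.H413 :=
  Summit.HodgeConjecture.CorCM.Hyp413Closing.H413_of_three_facts_flat hdictE (hJ3a_of_letters hE1 hE1'h hE1'a hE2' hDh hDa hEh hEa) hocc

end Summit.HodgeConjecture.HodgeConjecture.Cruxes.H413.HJ3aOfLetters

end
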